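import Summits.RiemannHypothesis.RiemannHypothesis.Theorems.TiltedLandingLaw421R3SinkTemplate
import Summits.RiemannHypothesis.RiemannHypothesis.Theorems.TiltedLandingLaw421R3FarPricing

/-!
# W-09 far branch · «SinkFeed» — the TREE-SIDE FEED of C3's η-free sink certificate (C4 kernel desk rh-idea-6 g43)

SUPPORT (K only; asserts no law; RH is NOT proved; ⟨33346⟩/⟨33347⟩ OPEN).  TWO imports, both landed: «SinkTemplate» (102, C3 rh-idea-3 g55:
the cut / certificate / kernel-domination vocabulary `Cut`, `Lcert`, `CutsAdmissible`, `MaxStrip`, `KernelDom`, `DatumAlt`, `CertificatesExistSig`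
and the abstract assembly `RhW08.SinkTemplate.sinkAssembly : AssemblySig`) and «FarPricing» (#1254: ★★ `im_lineRem_eq_farPull` = the row (E),
the re-pairing `tsum_conj_eq`).

CONTENT.  ★ `lcert_le_of_kernelDom`: on a legal frame `EngineHyps5 2 …` with the level-`j` seam `LevelRemainderBox` and `|Re v − x₀| ≤ R/2`, for a
SIMPLE `R/2`-isolated state `v` (m = 1), at every non-zero `w` of `f⁽ʲ⁾` with `0 < Im w`, `|Re w − Re v| ≤ R/3`, for every admissible cut family
`cs` on the axis `Re v` whose points are NON-ZEROS with `0 < Im p_k ≤ hmax` (this binder is where the cut point `p_k = v` is excluded) and every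
`σ` with the kernel domination (K) `KernelDom v.re R cs w σ`:  `Lcert cs (lineRem f j v R w) σ ≤ η/s` — i.e. EVERY hypothesis of `AssemblySig`
discharged from the tree, (K) left standing.  Dictionary: `ι, a` = #1251's UNPAIRED far list (through ★★); weights `m ≡ 1/2` (`farPairK u`
counts `u` and `ū`, each a separate entry of the list — right for real far zeros too); `MaxStrip` from the far clause, the zero strip
`RhW08.Column.abs_im_le_of_level` and `2·Hs ≤ R`; (E) from ★★ + `tsum_conj_eq`; the seam reads from `LevelRemainderBox` at any non-zero axis
point of the box (`norm_lineRem_le_of_seam`, the unfolding of `RhW08.FLink.lineRemainderAt_of_levelRemainderBox` at a general axis point); the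
two-point rows from ★★'s re-exported #1251 clause; the CONJ-SIDE summabilities (the one new estimate) from `norm_sub_le_conj`:
‖p − a‖ ≤ (1 + 12·Hs/R)·‖p − ā‖ on the slab, so the reflected sources are dominated by `(1 + 12·Hs/R)²` × the list's own terms
(`inv_norm_mul_conj_le`), which are absolutely summable because ℂ is finite-dimensional (`summable_inv_norm_mul`, reference family
Σ 1/‖w − aᵢ‖² via an auxiliary non-zero `z′ ≠ w`, `exists_ne_nonzero`, `summable_inv_norm_sq`).
★ `le_of_certificate`: add C3's datum row (D) `DatumAlt lam s gnorm cs (lineRem f j v R w) σ` with `0 < lam` ⇒ `gnorm ≤ lam·η/s` (the second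
disjunct dies on the cap `2·η ≤ 1` of the frame).  ★ `norm_farFieldAt_le_of_certificatesExist`: 102's certificate claim `CertificatesExistSig lam`
(its §6, at `mult = 1`, `xv = Re v`, `h = hmax`) CLOSES the sink conclusion `‖farFieldAt f j v w‖ ≤ lam·η/s` of `FarFieldModulusLawBoxPl lam` at
every simple state STRICTLY BELOW THE LID (`Im v < hmax`: the top cut point `⟨Re v, hmax⟩` is then a non-zero) and every nested child of drop
`< s/4` (the tree's `‖w − Re v‖ ≤ |Im v|` and `RhW08.BurgersRateG3.quarter_high_of_charged`).  So for m = 1 below the lid exactly 102's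
`CertificatesExistSig` — its kernel law (K) and datum row (D) — stands between the tree and the sink inequality; nothing on the (E) / seam /
assembly side.  LEFT: states of multiplicity ≥ 2 (needs the general-multiplicity two-point law), the lid case `Im v = hmax`.
No def, no twin of an importable statement (tree facts cited by name: `lineRem_eq_farFieldAt_of_simple`, `farFieldAt_child`, `iteratedDeriv_conj`,
`analyticOrderAt_conj_eq`, `RhW08.Column.abs_im_le_of_level`, `RhW08.ClusterQ.R_pos_of_engine`, `RhW08.GainSegment.differentiableAt_lineRem`,
`Complex.hasSum_re`, and the whole of #1254 / 102).
-/

noncomputable section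

namespace RhW08.SinkFeed

open Complex Filter Topology Set
open scoped ComplexConjugate
open RhW08.Round1 RhW08.StSwap RhW08.Round2 RhW08.QuadW
open RhW08.SealSwap (PBot)
open RhW08.SealSwapQ RhW08.RateSplit RhW08.IsolatedTilt RhW08.FarStep RhW08.BurgersRate RhW08.PurseP RhW08.BurgersRateG3
open RhIdea6.G17.W07C7 RhIdea6.G17.W07C7.Rev6 RhIdea6.G18.W07C8.Law421BirthS RhIdea6.G19.W07C11.Seam
open RhIdea6.G20.W07C12.Frac RhIdea6.G20.W07C12.StColP RhW07.C12.FieldSplit RhIdea6.G21.W07C13.TentMax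
open RhW07.C14.TwoSided RhW07.C14.Classes RhW07.C14.Lineage RhW07.C14.Booking
open RhW08.FLink RhW08.FLinkGain RhW08.FLinkGainSeam
open RhW08.GainTwoPoint RhW08.FarPricing RhW08.SinkTemplate

/-! ## §F1 Two elementary estimates -/

/-- (K) a summable family of two-point differences off the list (`z ≠ z'`) is absolutely summable:
`Σᵢ 1/(‖z − aᵢ‖·‖z' − aᵢ‖) < ∞` (ℂ is finite-dimensional). -/
theorem summable_inv_norm_mul {ι : Type} {a : ι → ℂ} {z z' : ℂ} (hzz' : z ≠ z') (hz : ∀ i, z ≠ a i) (hz' : ∀ i, z' ≠ a i)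
    (hd : Summable (fun i ↦ (1 / (z - a i) - 1 / (z' - a i)))) : Summable (fun i ↦ 1 / (‖z - a i‖ * ‖z' - a i‖)) := by
  have hn : Summable (fun i ↦ ‖1 / (z - a i) - 1 / (z' - a i)‖) := summable_norm_iff.mpr hd
  have hc : ‖z' - z‖ ≠ 0 := norm_ne_zero_iff.mpr (sub_ne_zero.mpr hzz'.symm)
  refine (hn.div_const ‖z' - z‖).congr fun i ↦ ?_
  have h1 : z - a i ≠ 0 := sub_ne_zero.mpr (hz i)
  have h2 : z' - a i ≠ 0 := sub_ne_zero.mpr (hz' i)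
  have h1' : ‖z - a i‖ ≠ 0 := norm_ne_zero_iff.mpr h1
  have h2' : ‖z' - a i‖ ≠ 0 := norm_ne_zero_iff.mpr h2
  have : 1 / (z - a i) - 1 / (z' - a i) = (z' - z) / ((z - a i) * (z' - a i)) := by
    field_simp
    ring
  rw [this, norm_div, norm_mul]
  field_simp

/-- (K) comparison with the REFLECTED source, seen from the slab `|Re p − Re v| ≤ R/3`: `‖p − a‖ ≤ (1 + 12·Hs/R)·‖p − ā‖`
(`‖ā − a‖ = 2|Im a| ≤ 2Hs` and `‖p − ā‖ ≥ R/6`). -/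
theorem norm_sub_le_conj {v p a : ℂ} {R Hs : ℝ} (hR : 0 < R) (ha : R / 2 ≤ |a.re - v.re|) (haHs : |a.im| ≤ Hs)
    (hp : |p.re - v.re| ≤ R / 3) : ‖p - a‖ ≤ (1 + 12 * Hs / R) * ‖p - conj a‖ := by
  have hfar' : R / 2 ≤ |(conj a).re - v.re| := by rwa [conj_re]
  have h6 : R / 6 ≤ ‖p - conj a‖ := norm_sub_far_ge hfar' hp
  have hre : (conj a - a).re = 0 := by simp
  have him : (conj a - a).im = -(2 * a.im) := by
    simp
    ring
  have hca : ‖conj a - a‖ ≤ 2 * Hs := by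
    calc ‖conj a - a‖ ≤ |(conj a - a).re| + |(conj a - a).im| := Complex.norm_le_abs_re_add_abs_im _
      _ = 2 * |a.im| := by rw [hre, him, abs_zero, zero_add, abs_neg, abs_mul, abs_two]
      _ ≤ 2 * Hs := by linarith
  have htri : ‖p - a‖ ≤ ‖p - conj a‖ + ‖conj a - a‖ := norm_sub_le_norm_sub_add_norm_sub _ _ _
  have hHs0 : 0 ≤ Hs := (abs_nonneg _).trans haHs
  have h12 : 12 * Hs / R * (R / 6) = 2 * Hs := by
    field_simp
    ring
  have h12' : 12 * Hs / R * (R / 6) ≤ 12 * Hs / R * ‖p - conj a‖ := mul_le_mul_of_nonneg_left h6 (by positivity)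
  calc ‖p - a‖ ≤ ‖p - conj a‖ + 2 * Hs := by linarith
    _ ≤ ‖p - conj a‖ + 12 * Hs / R * ‖p - conj a‖ := by linarith
    _ = (1 + 12 * Hs / R) * ‖p - conj a‖ := by ring

/-! ## §F2 The seam, read at an axis point -/

/-- (K) the level-`j` seam read at ANY non-zero axis point `p` of the box (`Re p = Re v`, `|Im p| ≤ hmax`): `‖lineRem f j v R p‖ ≤ η/s`
(the window of `RemainderBox` at `p` is `v`'s window; cf. `lineRemainderAt_of_levelRemainderBox` for `p = linePt v w`). -/
theorem norm_lineRem_le_of_seam {η : ℝ} {f : ℂ → ℂ} {x₀ s hmax R : ℝ} {j : ℕ} (hRB : LevelRemainderBox η f x₀ s hmax R j) {v p : ℂ}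
    (hpre : p.re = v.re) (hcol : |v.re - x₀| ≤ R / 2) (hpim : |p.im| ≤ hmax) (hp0 : iteratedDeriv j f p ≠ 0) :
    ‖lineRem f j v R p‖ ≤ η / s := by
  have key := hRB p (by rw [hpre]; exact hcol) hpim hp0
  rw [hpre] at key
  simpa only [lineRem, levelField, iteratedDeriv_succ] using key

/-! ## §F3 Helpers on a far list seen from the slab -/

/-- (K) near a non-zero `w` of an entire `F` above the axis there is another one. -/
theorem exists_ne_nonzero {η : ℝ} {f : ℂ → ℂ} {x₀ s hmax R Hs : ℝ} {B : ℕ} (hE : EngineHyps5 2 η f x₀ s hmax R Hs B) (j : ℕ) {w : ℂ}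
    (hw : iteratedDeriv j f w ≠ 0) (hwim : 0 < w.im) : ∃ z', iteratedDeriv j f z' ≠ 0 ∧ 0 < z'.im ∧ z' ≠ w := by
  have h1 : ∀ᶠ z in 𝓝 w, iteratedDeriv j f z ≠ 0 := ((differentiable_level hE j).continuous.continuousAt).eventually_ne hw
  have h2 : ∀ᶠ z in 𝓝 w, z.im ∈ Ioi (0 : ℝ) := Complex.continuous_im.continuousAt.eventually_mem (Ioi_mem_nhds hwim)
  have h12 : ∀ᶠ z in 𝓝[≠] w, (iteratedDeriv j f z ≠ 0 ∧ z.im ∈ Ioi (0 : ℝ)) ∧ z ∈ ({w}ᶜ : Set ℂ) :=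
    ((h1.and h2).filter_mono nhdsWithin_le_nhds).and self_mem_nhdsWithin
  obtain ⟨z', ⟨h0, him⟩, hne⟩ := h12.exists
  exact ⟨z', h0, him, hne⟩

/-- (K) reference summability `Σ 1/‖w − aᵢ‖² < ∞` from `Σ 1/(‖w − aᵢ‖‖z' − aᵢ‖) < ∞` (far list, `w` in the slab). -/
theorem summable_inv_norm_sq {ι : Type} {a : ι → ℂ} {v w z' : ℂ} {R : ℝ} (hR : 0 < R) (hfar : ∀ i, R / 2 ≤ |(a i).re - v.re|)
    (hwre : |w.re - v.re| ≤ R / 3) (hwa : ∀ i, w ≠ a i) (hza : ∀ i, z' ≠ a i)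
    (h1 : Summable (fun i ↦ 1 / (‖w - a i‖ * ‖z' - a i‖))) : Summable (fun i ↦ 1 / (‖w - a i‖ * ‖w - a i‖)) := by
  refine Summable.of_nonneg_of_le (fun i ↦ by positivity) (fun i ↦ ?_) (h1.mul_left (1 + 6 * ‖z' - w‖ / R))
  have hle : ‖z' - a i‖ ≤ (1 + 6 * ‖z' - w‖ / R) * ‖w - a i‖ := norm_sub_far_le hR (hfar i) hwre
  have hwa' : 0 < ‖w - a i‖ := norm_pos_iff.mpr (sub_ne_zero.mpr (hwa i))
  have hza' : 0 < ‖z' - a i‖ := norm_pos_iff.mpr (sub_ne_zero.mpr (hza i))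
  rw [mul_one_div, div_le_div_iff₀ (mul_pos hwa' hwa') (mul_pos hwa' hza'), one_mul]
  calc ‖w - a i‖ * ‖z' - a i‖ ≤ ‖w - a i‖ * ((1 + 6 * ‖z' - w‖ / R) * ‖w - a i‖) := mul_le_mul_of_nonneg_left hle hwa'.le
    _ = (1 + 6 * ‖z' - w‖ / R) * (‖w - a i‖ * ‖w - a i‖) := by ring

/-- (K) domination of the REFLECTED sources: `1/(‖p − ā‖‖q − ā‖) ≤ K²/(‖p − a‖‖q − a‖)`, `K = 1 + 12Hs/R`, for slab points `p, q`
off `a, ā` and a far source `a` in the strip. -/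
theorem inv_norm_mul_conj_le {v p q a : ℂ} {R Hs : ℝ} (hR : 0 < R) (ha : R / 2 ≤ |a.re - v.re|) (haHs : |a.im| ≤ Hs)
    (hp : |p.re - v.re| ≤ R / 3) (hq : |q.re - v.re| ≤ R / 3) (hpa : p ≠ a) (hqa : q ≠ a) (hpc : p ≠ conj a) (hqc : q ≠ conj a) :
    1 / (‖p - conj a‖ * ‖q - conj a‖) ≤ (1 + 12 * Hs / R) ^ 2 * (1 / (‖p - a‖ * ‖q - a‖)) := by
  have hHs0 : 0 ≤ Hs := (abs_nonneg _).trans haHs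
  have hpa' : 0 < ‖p - a‖ := norm_pos_iff.mpr (sub_ne_zero.mpr hpa)
  have hqa' : 0 < ‖q - a‖ := norm_pos_iff.mpr (sub_ne_zero.mpr hqa)
  have hpc' : 0 < ‖p - conj a‖ := norm_pos_iff.mpr (sub_ne_zero.mpr hpc)
  have hqc' : 0 < ‖q - conj a‖ := norm_pos_iff.mpr (sub_ne_zero.mpr hqc)
  have hK0 : 0 ≤ 1 + 12 * Hs / R := by positivity
  rw [mul_one_div, div_le_div_iff₀ (mul_pos hpc' hqc') (mul_pos hpa' hqa'), one_mul, pow_two]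
  calc ‖p - a‖ * ‖q - a‖ ≤ ((1 + 12 * Hs / R) * ‖p - conj a‖) * ((1 + 12 * Hs / R) * ‖q - conj a‖) :=
        mul_le_mul (norm_sub_le_conj hR ha haHs hp) (norm_sub_le_conj hR ha haHs hq) hqa'.le (by positivity)
    _ = (1 + 12 * Hs / R) * (1 + 12 * Hs / R) * (‖p - conj a‖ * ‖q - conj a‖) := by ring

/-! ## §F4 THE FEED: every hypothesis of `AssemblySig` from the tree; (K) stays the hypothesis -/

/-- ★ (K) **TREE-SIDE SINK ASSEMBLY** for a simple `R/2`-isolated state `v` on a legal frame with the level-`j` seam: at every non-zero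
`w` of `f⁽ʲ⁾` above the axis in the slab `|Re w − Re v| ≤ R/3`, for every admissible cut family on the axis whose points are non-zeros
with `0 < Im p_k ≤ hmax`, and every multiplier `σ` with kernel domination (K) on the maximal strip:  `L_cert ≤ η/s`. -/
theorem lcert_le_of_kernelDom {η : ℝ} {f : ℂ → ℂ} {x₀ s hmax R Hs : ℝ} {B : ℕ} (hE : EngineHyps5 2 η f x₀ s hmax R Hs B) {j : ℕ}
    {v w : ℂ} (hRB : LevelRemainderBox η f x₀ s hmax R j) (hcol : |v.re - x₀| ≤ R / 2) (hFv : iteratedDeriv j f v = 0)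
    (hv0 : 0 < v.im) (hs : iteratedDeriv (j + 1) f v ≠ 0)
    (hiso : ∀ z : ℂ, iteratedDeriv j f z = 0 → |z.re - v.re| < R / 2 → z = v ∨ z = conj v)
    (hw : iteratedDeriv j f w ≠ 0) (hwim : 0 < w.im) (hwre : |w.re - v.re| ≤ R / 3)
    {κ : Type} [Fintype κ] {cs : κ → Cut} (hadm : CutsAdmissible v.re cs) (hp0 : ∀ k, iteratedDeriv j f (cs k).p ≠ 0)
    (hpim : ∀ k, 0 < (cs k).p.im ∧ (cs k).p.im ≤ hmax) {σ : ℝ} (hK : KernelDom v.re R cs w σ) :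
    Lcert cs (lineRem f j v R w) σ ≤ η / s := by
  obtain ⟨ι, a, hfar, -, -, hexp, htwo, hpull⟩ := im_lineRem_eq_farPull hE hFv hv0 hs hiso
  have hR : 0 < R := RhW08.ClusterQ.R_pos_of_engine hE
  have hHs0 : 0 ≤ Hs := hE.2.2.2.2.2.2.2.1
  have hHsR : 2 * Hs ≤ R := hE.2.2.2.2.2.2.2.2.2.1
  -- the reflection-symmetric multiplicity of the export
  set n : ℂ → ℝ := fun c ↦ (if c = v ∨ c = conj v then (0 : ℝ) else (analyticOrderNatAt (iteratedDeriv j f) c : ℝ)) with hndef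
  have hn : ∀ c, n (conj c) = n c := by
    intro c
    have h1 : (conj c = v ∨ conj c = conj v) ↔ (c = v ∨ c = conj v) := by
      constructor
      · rintro (h | h)
        · exact Or.inr (by rw [← h, conj_conj])
        · exact Or.inl (by simpa using congrArg conj h)
      · rintro (h | h)
        · exact Or.inr (by rw [h])
        · exact Or.inl (by rw [h, conj_conj])
    simp only [hndef, h1, analyticOrderNatAt, analyticOrderAt_conj_eq hE]
  -- the list: far, in the strip, reflected entries are zeros too; non-zeros avoid the list and its reflection
  have hnz : iteratedDeriv j f ≠ 0 := fun h ↦ hw (by rw [h]; rfl)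
  have hfar' : ∀ i, R / 2 ≤ |(a i).re - v.re| := fun i ↦ (hfar i).2
  have hstripa : ∀ i, |(a i).im| ≤ Hs := fun i ↦ RhW08.Column.abs_im_le_of_level hE hnz (hfar i).1
  have hconj0 : ∀ i, iteratedDeriv j f (conj (a i)) = 0 := fun i ↦ by rw [iteratedDeriv_conj hE, (hfar i).1, map_zero]
  have hav : ∀ {z : ℂ}, iteratedDeriv j f z ≠ 0 → ∀ i, z ≠ a i := fun hz i h ↦ hz (by rw [h]; exact (hfar i).1)
  have havc : ∀ {z : ℂ}, iteratedDeriv j f z ≠ 0 → ∀ i, z ≠ conj (a i) := fun hz i h ↦ hz (by rw [h]; exact hconj0 i)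
  -- the cut points: on the axis, in the slab
  have hpre : ∀ k, (cs k).p.re = v.re := fun k ↦ (hadm.1 k).2.2
  have hpslab : ∀ k, |(cs k).p.re - v.re| ≤ R / 3 := fun k ↦ by
    rw [hpre k, sub_self, abs_zero]; positivity
  -- reference summability `Σ 1/‖w − aᵢ‖² < ∞` via an auxiliary non-zero `z' ≠ w`, and the reflected-source domination constant
  obtain ⟨z', hz'0, hz'im, hz'w⟩ := exists_ne_nonzero hE j hw hwim
  have hsq : Summable (fun i ↦ 1 / (‖w - a i‖ * ‖w - a i‖)) :=
    summable_inv_norm_sq hR hfar' hwre (hav hw) (hav hz'0)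
      (summable_inv_norm_mul hz'w.symm (hav hw) (hav hz'0) (htwo w z' hw hwim hz'0 hz'im).1)
  set K : ℝ := 1 + 12 * Hs / R with hKdef
  have hdom : ∀ {p q : ℂ}, |p.re - v.re| ≤ R / 3 → |q.re - v.re| ≤ R / 3 → iteratedDeriv j f p ≠ 0 → iteratedDeriv j f q ≠ 0 →
      ∀ i, 1 / (‖p - conj (a i)‖ * ‖q - conj (a i)‖) ≤ K ^ 2 * (1 / (‖p - a i‖ * ‖q - a i‖)) :=
    fun hp hq hp0' hq0' i ↦ inv_norm_mul_conj_le hR (hfar' i) (hstripa i) hp hq (hav hp0' i) (hav hq0' i) (havc hp0' i) (havc hq0' i)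
  -- (a) the pull at `w` and its reflected twin are summable
  have hSw0 : Summable (fun i ↦ (1 / (w - a i)).im) := (hpull w hw hwim hwre).1
  have hSw : Summable (fun i ↦ (1 / (w - conj (a i))).im) := by
    refine Summable.of_norm_bounded ((hsq.mul_left (K ^ 2)).mul_left (|w.im| + Hs)) fun i ↦ ?_
    rw [Real.norm_eq_abs]
    have h1 := abs_im_one_div_sub_le (w := w) (a := conj (a i)) (Hs := Hs) hR (by rw [conj_re]; exact hfar' i)
      (by rw [conj_im, abs_neg]; exact hstripa i) hwre (havc hw i)
    rw [sub_self, norm_zero, mul_zero, zero_div, add_zero, one_pow, mul_one] at h1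
    exact h1.trans (mul_le_mul_of_nonneg_left (hdom hwre hwre hw hw i) (add_nonneg (abs_nonneg _) hHs0))
  -- (b) the two-point differences at `(w, p_k)` and their reflected twins are summable
  have hSc : ∀ k, Summable (fun i ↦ (1 / (w - conj (a i)) - 1 / ((cs k).p - conj (a i)))) := by
    intro k
    by_cases hwp : w = (cs k).p
    · rw [← hwp]
      simp only [sub_self]
      exact summable_zero
    have h1 := summable_inv_norm_mul hwp (hav hw) (hav (hp0 k)) (htwo w (cs k).p hw hwim (hp0 k) (hpim k).1).1
    refine Summable.of_norm_bounded ((h1.mul_left (K ^ 2)).mul_left ‖(cs k).p - w‖) fun i ↦ ?_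
    have e1 : w - conj (a i) ≠ 0 := sub_ne_zero.mpr (havc hw i)
    have e2 : (cs k).p - conj (a i) ≠ 0 := sub_ne_zero.mpr (havc (hp0 k) i)
    have : 1 / (w - conj (a i)) - 1 / ((cs k).p - conj (a i)) = ((cs k).p - w) / ((w - conj (a i)) * ((cs k).p - conj (a i))) := by
      field_simp
      ring
    rw [this, norm_div, norm_mul, div_eq_mul_one_div]
    exact mul_le_mul_of_nonneg_left (hdom hwre (hpslab k) hw (hp0 k) i) (norm_nonneg _)
  -- the pair kernel splits into the list term and its reflected twin
  have hpk : ∀ k i, farPairK (a i) w - farPairK (a i) (cs k).p =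
      (1 / (w - a i) - 1 / ((cs k).p - a i)) + (1 / (w - conj (a i)) - 1 / ((cs k).p - conj (a i))) := by
    intro k i
    unfold farPairK
    ring
  -- real parts along a direction
  have hgk : ∀ k, Summable (fun i ↦ (conj (cs k).e * (1 / (w - a i) - 1 / ((cs k).p - a i))).re) := fun k ↦
    (Complex.hasSum_re (((htwo w (cs k).p hw hwim (hp0 k) (hpim k).1).1).mul_left _).hasSum).summable
  have hgkc : ∀ k, Summable (fun i ↦ (conj (cs k).e * (1 / (w - conj (a i)) - 1 / ((cs k).p - conj (a i)))).re) := fun k ↦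
    (Complex.hasSum_re ((hSc k).mul_left _).hasSum).summable
  -- re-pairing: the reflected twins sum to the same value
  have hrep : ∀ k, ∑' i, (conj (cs k).e * (1 / (w - conj (a i)) - 1 / ((cs k).p - conj (a i)))).re =
      ∑' i, (conj (cs k).e * (1 / (w - a i) - 1 / ((cs k).p - a i))).re := fun k ↦
    tsum_conj_eq (g := fun c ↦ (conj (cs k).e * (1 / (w - c) - 1 / ((cs k).p - c))).re) hn hexp (hgk k) (hgkc k)
  have hrepI : ∑' i, (1 / (w - conj (a i))).im = ∑' i, (1 / (w - a i)).im :=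
    tsum_conj_eq (g := fun c ↦ (1 / (w - c)).im) hn hexp hSw0 hSw
  -- the hypotheses of `AssemblySig`, one by one
  have hm : ∀ _ : ι, (0 : ℝ) ≤ 1 / 2 := fun _ ↦ by norm_num
  have hstrip : ∀ i, MaxStrip v.re R (a i) := fun i ↦ ⟨hfar' i, (hstripa i).trans (by linarith)⟩
  have hsum : ∀ k, Summable fun i ↦ (1 / 2 : ℝ) * (conj (cs k).e * (farPairK (a i) w - farPairK (a i) (cs k).p)).re := by
    intro k
    refine (((hgk k).add (hgkc k)).mul_left (1 / 2)).congr fun i ↦ ?_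
    rw [hpk k i, mul_add (conj (cs k).e), add_re]
  have hsumc : Summable fun i ↦ (1 / 2 : ℝ) * farPairC w (a i) := by
    refine ((hSw0.add hSw).mul_left (-(1 / 2))).congr fun i ↦ ?_
    simp only [farPairC, farPairK, add_im]
    ring
  have hEq : -(lineRem f j v R w).im = ∑' i, (1 / 2 : ℝ) * farPairC w (a i) := by
    have e1 : ∀ i, (1 / 2 : ℝ) * farPairC w (a i) = -(1 / 2) * ((1 / (w - a i)).im + (1 / (w - conj (a i))).im) := by
      intro i
      simp only [farPairC, farPairK, add_im]
      ring
    rw [tsum_congr e1, tsum_mul_left, hSw0.tsum_add hSw, hrepI, (hpull w hw hwim hwre).2.1]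
    ring
  have hseam : ∀ k, (conj (cs k).e * lineRem f j v R w).re -
      ∑' i, (1 / 2 : ℝ) * (conj (cs k).e * (farPairK (a i) w - farPairK (a i) (cs k).p)).re ≤ η / s := by
    intro k
    have e1 : ∀ i, (1 / 2 : ℝ) * (conj (cs k).e * (farPairK (a i) w - farPairK (a i) (cs k).p)).re =
        (1 / 2 : ℝ) * ((conj (cs k).e * (1 / (w - a i) - 1 / ((cs k).p - a i))).re +
          (conj (cs k).e * (1 / (w - conj (a i)) - 1 / ((cs k).p - conj (a i)))).re) := by
      intro i
      rw [hpk k i, mul_add (conj (cs k).e), add_re]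
    obtain ⟨hd, hid⟩ := htwo w (cs k).p hw hwim (hp0 k) (hpim k).1
    have e2 : ∑' i, (conj (cs k).e * (1 / (w - a i) - 1 / ((cs k).p - a i))).re =
        (conj (cs k).e * (lineRem f j v R w - lineRem f j v R (cs k).p)).re := by
      rw [hid, ← tsum_mul_left, Complex.re_tsum (hd.mul_left _)]
    rw [tsum_congr e1, tsum_mul_left, (hgk k).tsum_add (hgkc k), hrep k, e2]
    have hseamk : ‖lineRem f j v R (cs k).p‖ ≤ η / s :=
      norm_lineRem_le_of_seam hRB (hpre k) hcol (by rw [abs_of_pos (hpim k).1]; exact (hpim k).2) (hp0 k)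
    have hre : (conj (cs k).e * lineRem f j v R (cs k).p).re ≤ η / s := by
      refine (Complex.re_le_norm _).trans ?_
      rw [norm_mul, Complex.norm_conj, (hadm.1 k).2.1, one_mul]
      exact hseamk
    have e3 : (conj (cs k).e * lineRem f j v R w).re -
        1 / 2 * ((conj (cs k).e * (lineRem f j v R w - lineRem f j v R (cs k).p)).re +
          (conj (cs k).e * (lineRem f j v R w - lineRem f j v R (cs k).p)).re) =
        (conj (cs k).e * lineRem f j v R (cs k).p).re := by
      rw [mul_sub, sub_re]
      ring
    rw [e3]
    exact hre
  exact sinkAssembly κ ι a (fun _ ↦ 1 / 2) v.re R cs w (lineRem f j v R w) (η / s) σ hm hstrip hadm hK hsum hsumc hEq hseam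

/-- ★ (K) **CERTIFICATE ⇒ SINK INEQUALITY**: with C3's datum alternative (D) for an exponent `lam > 0` and any modulus `gnorm` (the sink takes
`gnorm = ‖farFieldAt f j v w‖`) on top of (K), the frame's cap `2η ≤ 1` turns `L_cert ≤ η/s` into `gnorm ≤ lam·η/s` — the shape of the conclusion of
`RhW08.FLink.FarFieldModulusLawBoxPl lam` at `w` (m = 1 state: `G = lineRem f j v R w = farFieldAt f j v w` by `lineRem_eq_farFieldAt_of_simple`). -/
theorem le_of_certificate {η : ℝ} {f : ℂ → ℂ} {x₀ s hmax R Hs : ℝ} {B : ℕ} (hE : EngineHyps5 2 η f x₀ s hmax R Hs B)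
    {j : ℕ} {v w : ℂ} (hRB : LevelRemainderBox η f x₀ s hmax R j) (hcol : |v.re - x₀| ≤ R / 2) (hFv : iteratedDeriv j f v = 0)
    (hv0 : 0 < v.im) (hs : iteratedDeriv (j + 1) f v ≠ 0)
    (hiso : ∀ z : ℂ, iteratedDeriv j f z = 0 → |z.re - v.re| < R / 2 → z = v ∨ z = conj v)
    (hw : iteratedDeriv j f w ≠ 0) (hwim : 0 < w.im) (hwre : |w.re - v.re| ≤ R / 3)
    {κ : Type} [Fintype κ] {cs : κ → Cut} (hadm : CutsAdmissible v.re cs) (hp0 : ∀ k, iteratedDeriv j f (cs k).p ≠ 0)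
    (hpim : ∀ k, 0 < (cs k).p.im ∧ (cs k).p.im ≤ hmax) {σ lam gnorm : ℝ} (hlam : 0 < lam) (hK : KernelDom v.re R cs w σ)
    (hD : DatumAlt lam s gnorm cs (lineRem f j v R w) σ) : gnorm ≤ lam * η / s := by
  have hL := lcert_le_of_kernelDom hE hRB hcol hFv hv0 hs hiso hw hwim hwre hadm hp0 hpim hK
  have hs0 : 0 < s := hE.2.2.2.1
  have hη2 : 2 * η ≤ 1 := hE.2.2.2.2.2.2.2.2.2.2.2.2.2.2.1
  rcases hD with h | h
  · have h' := h.trans hL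
    rw [div_le_iff₀ hlam] at h'
    calc gnorm ≤ η / s * lam := h'
      _ = lam * η / s := by ring
  · exfalso
    have h1 : 1 / (2 * s) < η / s := h.trans_le hL
    rw [div_lt_div_iff₀ (by positivity) hs0] at h1
    nlinarith

/-- ★ (K) **102's `CertificatesExistSig lam` CLOSES THE SINK at a simple state strictly below the lid**: for a legal frame with the level-`j`
seam, a simple `R/2`-isolated state `v` with `Im v < hmax` (the Q-edge: the top cut point `⟨Re v, hmax⟩` must not be `v` itself, where
`lineRem` is Lean-junk) and a child `w` in the nested disc of drop `< s/4` (the tree's binders: `‖w − Re v‖ ≤ |Im v|`, and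
`RhW08.BurgersRateG3.quarter_high_of_charged` for the drop), C3's certificate claim gives `‖farFieldAt f j v w‖ ≤ lam·η/s`. -/
theorem norm_farFieldAt_le_of_certificatesExist {lam : ℝ} (hcert : CertificatesExistSig lam) (hlam : 0 < lam) {η : ℝ} {f : ℂ → ℂ}
    {x₀ s hmax R Hs : ℝ} {B : ℕ} (hE : EngineHyps5 2 η f x₀ s hmax R Hs B) {j : ℕ} {v w : ℂ} (hRB : LevelRemainderBox η f x₀ s hmax R j)
    (hcol : |v.re - x₀| ≤ R / 2) (hFv : iteratedDeriv j f v = 0) (hv0 : 0 < v.im) (hvh : v.im < hmax) (hs : iteratedDeriv (j + 1) f v ≠ 0)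
    (hiso : ∀ z : ℂ, iteratedDeriv j f z = 0 → |z.re - v.re| < R / 2 → z = v ∨ z = conj v)
    (hw : iteratedDeriv j f w ≠ 0) (hw' : iteratedDeriv (j + 1) f w = 0) (hwim : 0 < w.im) (hdrop : v.im - s / 4 < w.im)
    (hdisc : ‖w - (v.re : ℂ)‖ ≤ |v.im|) : ‖farFieldAt f j v w‖ ≤ lam * η / s := by
  have hs0 : 0 < s := hE.2.2.2.1
  have h2s : 2 * s ≤ hmax := hE.2.2.2.2.1
  have h3R : 3 * hmax < R := hE.2.2.2.2.2.2.1
  have hR : 0 < R := RhW08.ClusterQ.R_pos_of_engine hE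
  -- the nested disc in coordinates
  have hdisc' : ‖w - (v.re : ℂ)‖ ≤ v.im := by rwa [abs_of_pos hv0] at hdisc
  have hn2 : ‖w - (v.re : ℂ)‖ ^ 2 = (w.re - v.re) ^ 2 + w.im ^ 2 := by
    rw [Complex.sq_norm, Complex.normSq_apply]
    simp
    ring
  have hsq : (w.re - v.re) ^ 2 + w.im ^ 2 ≤ v.im ^ 2 := by
    rw [← hn2]
    exact pow_le_pow_left₀ (norm_nonneg _) hdisc' 2
  have hwle : w.im ≤ v.im := by
    have h := abs_le_of_sq_le_sq (a := w.im) (b := v.im) (by nlinarith [sq_nonneg (w.re - v.re)]) hv0.le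
    rwa [abs_of_pos hwim] at h
  have hwlt : w.im < v.im := by
    rcases lt_or_eq_of_le hwle with h | h
    · exact h
    · exfalso
      have hre : (w.re - v.re) ^ 2 ≤ 0 := by nlinarith
      have hre0 : w.re - v.re = 0 := pow_eq_zero_iff two_ne_zero |>.mp (le_antisymm hre (sq_nonneg _))
      exact hw (by rw [Complex.ext (by linarith) h]; exact hFv)
  have hwre : |w.re - v.re| ≤ R / 3 := by
    have h1 : |w.re - v.re| ≤ v.im := abs_le_of_sq_le_sq (by nlinarith [sq_nonneg w.im]) hv0.le
    linarith
  -- C3's certificate for multiplicity 1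
  obtain ⟨n, cs, σ, hadm, hpts, hK, hD⟩ :=
    hcert v.re R s hmax v w 1 hs0 h2s h3R rfl hv0 hvh.le hwim hwlt hdrop hsq le_rfl
  -- the cut points are non-zeros of the box, off `v`
  have hpfacts : ∀ k, iteratedDeriv j f (cs k).p ≠ 0 ∧ 0 < (cs k).p.im ∧ (cs k).p.im ≤ hmax := by
    intro k
    have hoff : ∀ p : ℂ, p.re = v.re → 0 < p.im → p.im ≠ v.im → iteratedDeriv j f p ≠ 0 := by
      intro p hpre hpim hpv hz
      rcases hiso p hz (by rw [hpre, sub_self, abs_zero]; linarith) with h | h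
      · exact hpv (by rw [h])
      · have : p.im = -v.im := by rw [h, conj_im]
        linarith
    rcases hpts k with h | h
    · have hre : (cs k).p.re = v.re := by rw [h]
      have him : (cs k).p.im = w.im := by rw [h]
      exact ⟨hoff _ hre (by rw [him]; exact hwim) (by rw [him]; exact hwlt.ne), by rw [him]; exact hwim, by rw [him]; linarith⟩
    · have hre : (cs k).p.re = v.re := by rw [h]
      have him : (cs k).p.im = hmax := by rw [h]
      exact ⟨hoff _ hre (by rw [him]; linarith) (by rw [him]; exact hvh.ne'), by rw [him]; linarith, by rw [him]⟩
  -- the read value of the certificate is the line remainder, the bounded modulus is the far field (m = 1)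
  have hL1 : lineRem f j v R w = -(farPairK v w) := by
    rw [lineRem_eq_farFieldAt_of_simple hE hFv hs hv0 hiso, farFieldAt_child v hw', farPairK]
    simp only [one_div]
  have hN : ‖farPairK v w‖ = ‖farFieldAt f j v w‖ := by
    rw [← lineRem_eq_farFieldAt_of_simple hE hFv hs hv0 hiso, hL1, norm_neg]
  rw [Nat.cast_one, one_mul, ← hL1, hN] at hD
  exact le_of_certificate hE hRB hcol hFv hv0 hs hiso hw hwim hwre hadm (fun k ↦ (hpfacts k).1) (fun k ↦ (hpfacts k).2) hlam hK hD

end RhW08.SinkFeed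

end
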